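/-
Copyright: statement-level skeleton of a published paper (lit-balaban cell, Phase-2 proof seat p25, gen 17). No proof
claims beyond what the kernel checks below.
-/
import Literature.MathematicalPhysics.QuantumFieldTheory.BalabanImbrieJaffe1984to88.BIJ88LabelledDiamDecay312
import Literature.Analysis.OperatorTheory.CombesThomasBanded

/-!
# `BalabanImbrieJaffe1984to88.BIJ88BracketDecay311` — T. Bałaban, J. Imbrie, A. Jaffe, *Effective action and cluster
properties of the abelian Higgs model*, Commun. Math. Phys. **114** (1988) 257–315 [BalabanImbrieJaffe1988], §5.14
p. 311 [PDF 55]: *"Each F^{m̄}_{k,loc}(X_{σ_i}) is a polynomial in A^{(k)}, φ^{(k)}; those fields can be contracted via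
covariances C^{(k)}_{Λ(k)} or C^{(k)}_{Λ(k)}(u_{k+1}) to other observables, to χ′_{Λ(k)}, or to the interaction."* —
**THE DECAY HYPOTHESIS OF `BIJ88LabelledDiamDecay312` DISCHARGED FOR A BANDED COERCIVE PRECISION.**  The located decay
bounds of p25 gen 17 (`run_decay_bound`, `expand_decay_bound_init`) assume `|⟨A⁻¹u, v⟩| ≤ B·e^{−δ·dist(loc u, loc v)}`
for the legs in play.  When the sites `S` carry a pseudo-distance, the precision `A` of the Gaussian `dμ_{C,ℱ}`
(`C = A⁻¹`) is BANDED (`A_{xy} = 0` for `dist x y > 1`) and COERCIVE (`⟨ω, Aω⟩ ≥ σ‖ω‖²`), and every leg is a test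
function supported within `r₁` of its location with `ℓ¹`-norm `≤ L₁`, the tree's finite-dimensional Combes–Thomas
estimate (`Literature.Analysis.OperatorTheory.combesThomas_banded`, [CombesThomas1973]) gives exactly that shape:
`|⟨A⁻¹u, v⟩| ≤ (2/σ)·e^{2μr₁}·L₁² · e^{−μ·dist(loc u, loc v)}` (`bracket_decay`), and `|⟨A⁻¹u, ℱ⟩| ≤ (2/σ)·L₁·‖ℱ‖₁`
(`bracket_source_le`); hence the diameter decay of every block and remainder component holds for such precisions with
explicit constants (`expand_decay_bound_banded`).  (Print's covariances `C^{(k)}` are Bałaban's multi-scale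
propagators with their own decay estimates [refs. 3–5 of the paper]; the banded coercive case is the elementary model —
e.g. `A = −Δ + m²` on a lattice — not those estimates.)

statement-level skeleton of published theorems with citation tags; proofs where landed; nothing here is a claim
about the Yang–Mills mass gap

PDF held: `paper:balaban1988-cmp114-bij-abelian-higgs-effective-action` (journal page = PDF page + 256); p. 311 = PDF 55
(`p0055.txt` L25–27 re-read this session; the quoted sentence is verbatim there up to the OCR of sub/superscripts).

CITATION HEADER (lean-in-tree rule).  lit-balaban cell (HOME `run/shared/lean/pub/lit-balaban/`), Phase 2, seat p25
gen 17; row **C2.Claim@312** of `HOME/lit-balaban-r16/ROWS-C2-part2.md` (owner r16, referee ref-5; head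
`BIJ88Sect5StatementsPart4.Ineq312` NOT touched — a MEMBER, model instance of the decay hypothesis).  USED BY NAME,
nothing restated: `Literature.Analysis.OperatorTheory.combesThomas_banded` ([CombesThomas1973]),
`BIJ88LabelledDiamDecay312.expand_decay_bound_init`, `BIJ88ComponentCubes311.cubes`, `BIJ88LabelledExpansion311.expand`.

## What is proved (0 `sorry`, standard axioms, no definitions, no `Prop` facts)

* §1 `isUnit_det_of_coercive`, **`inv_entry_decay`** (`|A⁻¹ x y| ≤ (2/σ) e^{−μ dist x y}`), **`bracket_decay`**,
  **`bracket_source_le`**.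
* §2 **`expand_decay_bound_banded`** — `expand_decay_bound_init` with its bracket hypotheses discharged.
HONEST SCOPE: finite-range (banded) coercive precisions only, `μ` limited by `h z (e^μ − 1) ≤ σ/2`; legs `ℓ¹`-bounded and
`r₁`-localized; diameter decay as in the sibling (not connectedness / tree decay); nothing of Bałaban's propagator
estimates is used.  CURRENCY: feeds none of `BIJ88Sect5StatementsPart4.Ineq312` / `hobs` / `RemainderComponent` by name,
instantiates none of `Ineq312`'s binders.  NOT summit progress; NOT continuum; NOT Clay.  Imports
`BIJ88LabelledDiamDecay312`, `Literature.Analysis.OperatorTheory.CombesThomasBanded`; modifies nothing.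
-/

noncomputable section

namespace Literature.MathematicalPhysics.QuantumFieldTheory.BalabanImbrieJaffe1984to88.BIJ88BracketDecay311

open Classical Matrix Finset
open scoped BigOperators
open BIJ88VertexComponents311 (Grp maxArity)
open BIJ88LabelledRun311 BIJ88LabelledExpansion311 BIJ88ComponentCubes311 BIJ88LabelledDiamDecay312

variable {S : Type} [Fintype S] [DecidableEq S] [PseudoMetricSpace S]

/-! ## §1  Banded coercive precisions: Combes–Thomas decay of the inverse and of the brackets -/

section Brackets

variable {A : Matrix S S ℝ} {σ h z μ : ℝ}

omit [PseudoMetricSpace S] in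
/-- A coercive matrix (`⟨ω, Aω⟩ ≥ σ‖ω‖²`, `σ > 0`) is invertible. [folklore] [cite: CombesThomas1973, §II] -/
theorem isUnit_det_of_coercive (hσ : 0 < σ) (hpos : ∀ ω : S → ℝ, σ * (ω ⬝ᵥ ω) ≤ ω ⬝ᵥ A.mulVec ω) : IsUnit A.det := by
  rw [isUnit_iff_ne_zero, Ne, ← Matrix.exists_mulVec_eq_zero_iff]
  rintro ⟨v, hv, hAv⟩
  have h1 := hpos v
  rw [hAv, dotProduct_zero] at h1
  have h2 : v ⬝ᵥ v ≤ 0 := by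
    by_contra h3
    exact absurd h1 (not_le.2 (mul_pos hσ (not_le.1 h3)))
  exact hv (dotProduct_self_eq_zero.1 (le_antisymm h2 (Finset.sum_nonneg fun i _ => mul_self_nonneg (v i))))

/-- **Combes–Thomas decay of the covariance kernel** `C = A⁻¹` for a banded coercive precision: `A_{xy} = 0` when
`dist x y > 1`, off-diagonal entries `≤ h`, at most `z` neighbours, `⟨ω, Aω⟩ ≥ σ‖ω‖²`, `h z (e^μ − 1) ≤ σ/2` ⇒
`|A⁻¹ x y| ≤ (2/σ) e^{−μ dist x y}` (the tree's `combesThomas_banded` applied to the column `A⁻¹ e_y`).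
[cite: CombesThomas1973, §II] -/
theorem inv_entry_decay (hσ : 0 < σ) (hμ : 0 ≤ μ) (hband : ∀ i k : S, 1 < dist i k → A i k = 0) (hh0 : 0 ≤ h)
    (hh : ∀ i k : S, i ≠ k → |A i k| ≤ h) (hz : ∀ i : S, ((univ.filter fun k => k ≠ i ∧ dist i k ≤ 1).card : ℝ) ≤ z)
    (hpos : ∀ ω : S → ℝ, σ * (ω ⬝ᵥ ω) ≤ ω ⬝ᵥ A.mulVec ω) (hsmall : h * z * (Real.exp μ - 1) ≤ σ / 2) (x y : S) :
    |A⁻¹ x y| ≤ 2 / σ * Real.exp (-(μ * dist x y)) := by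
  have hdet := isUnit_det_of_coercive hσ hpos
  have hv : A.mulVec (fun j => A⁻¹ j y) = Pi.single y 1 := by
    ext j
    have e := congrFun (congrFun (Matrix.mul_nonsing_inv A hdet) j) y
    rw [Matrix.mul_apply] at e
    rw [Matrix.mulVec, dotProduct, e, Matrix.one_apply, Pi.single_apply]
  exact _root_.Literature.Analysis.OperatorTheory.combesThomas_banded A dist σ h z μ hσ hμ dist_self dist_comm
    dist_triangle hband hh0 hh hz hpos hsmall y _ hv x

/-- **THE BRACKETS DECAY** (the hypothesis `hBd` of `BIJ88LabelledDiamDecay312.run_decay_bound`, discharged): for legs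
`u, v ∈ Dir`, each supported within `r₁` of its location `loc` and of `ℓ¹`-norm `≤ L₁`,
`|⟨A⁻¹u, v⟩| ≤ (2/σ)·e^{2μ r₁}·L₁² · e^{−μ·dist(loc u, loc v)}`. [cite: CombesThomas1973, §II]
[cite: BalabanImbrieJaffe1988, §5.14 p.311] -/
theorem bracket_decay (hσ : 0 < σ) (hμ : 0 ≤ μ) (hband : ∀ i k : S, 1 < dist i k → A i k = 0) (hh0 : 0 ≤ h)
    (hh : ∀ i k : S, i ≠ k → |A i k| ≤ h) (hz : ∀ i : S, ((univ.filter fun k => k ≠ i ∧ dist i k ≤ 1).card : ℝ) ≤ z)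
    (hpos : ∀ ω : S → ℝ, σ * (ω ⬝ᵥ ω) ≤ ω ⬝ᵥ A.mulVec ω) (hsmall : h * z * (Real.exp μ - 1) ≤ σ / 2)
    {Dir : Set (S → ℝ)} (loc : (S → ℝ) → S) {r₁ L₁ : ℝ} (hL : 0 ≤ L₁)
    (hsupp : ∀ w ∈ Dir, ∀ x, w x ≠ 0 → dist x (loc w) ≤ r₁) (hl1 : ∀ w ∈ Dir, ∑ x, |w x| ≤ L₁) :
    ∀ u ∈ Dir, ∀ v ∈ Dir,
      |(A⁻¹ *ᵥ u) ⬝ᵥ v| ≤ 2 / σ * Real.exp (2 * μ * r₁) * L₁ ^ 2 * Real.exp (-(μ * dist (loc u) (loc v))) := by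
  intro u hu v hv
  have hσ0 : 0 ≤ 2 / σ := div_nonneg zero_le_two hσ.le
  -- the bracket as a double sum
  have e : (A⁻¹ *ᵥ u) ⬝ᵥ v = ∑ i, ∑ k, A⁻¹ i k * u k * v i := by
    simp only [dotProduct, Matrix.mulVec, Finset.sum_mul]
  rw [e]
  -- each entry: |A⁻¹ i k u_k v_i| ≤ (2/σ) e^{2μr₁} e^{−μ D} |u_k| |v_i|
  have hterm : ∀ i k, |A⁻¹ i k * u k * v i|
      ≤ 2 / σ * Real.exp (2 * μ * r₁) * Real.exp (-(μ * dist (loc u) (loc v))) * (|u k| * |v i|) := by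
    intro i k
    rw [abs_mul, abs_mul]
    by_cases hk : u k = 0
    · simp only [hk, abs_zero, mul_zero, zero_mul, le_refl]
    by_cases hi : v i = 0
    · simp only [hi, abs_zero, mul_zero, le_refl]
    have hD : dist (loc u) (loc v) ≤ r₁ + dist i k + r₁ := by
      have h1 := hsupp u hu k hk
      have h2 := hsupp v hv i hi
      calc dist (loc u) (loc v) ≤ dist (loc u) k + dist k (loc v) := dist_triangle _ _ _
        _ ≤ dist (loc u) k + (dist k i + dist i (loc v)) := by linarith [dist_triangle k i (loc v)]
        _ ≤ r₁ + dist i k + r₁ := by rw [dist_comm (loc u) k, dist_comm k i]; linarith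
    have hent := inv_entry_decay hσ hμ hband hh0 hh hz hpos hsmall i k
    have hexp : Real.exp (-(μ * dist i k)) ≤ Real.exp (2 * μ * r₁) * Real.exp (-(μ * dist (loc u) (loc v))) := by
      rw [← Real.exp_add]
      exact Real.exp_le_exp.2 (by nlinarith)
    calc |A⁻¹ i k| * |u k| * |v i| = |A⁻¹ i k| * (|u k| * |v i|) := mul_assoc _ _ _
      _ ≤ (2 / σ * (Real.exp (2 * μ * r₁) * Real.exp (-(μ * dist (loc u) (loc v))))) * (|u k| * |v i|) :=
          mul_le_mul_of_nonneg_right (hent.trans (mul_le_mul_of_nonneg_left hexp hσ0))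
            (mul_nonneg (abs_nonneg _) (abs_nonneg _))
      _ = _ := by ring
  calc |∑ i, ∑ k, A⁻¹ i k * u k * v i| ≤ ∑ i, |∑ k, A⁻¹ i k * u k * v i| := Finset.abs_sum_le_sum_abs _ _
    _ ≤ ∑ i, ∑ k, |A⁻¹ i k * u k * v i| := Finset.sum_le_sum fun i _ => Finset.abs_sum_le_sum_abs _ _
    _ ≤ ∑ i, ∑ k, 2 / σ * Real.exp (2 * μ * r₁) * Real.exp (-(μ * dist (loc u) (loc v))) * (|u k| * |v i|) :=
        Finset.sum_le_sum fun i _ => Finset.sum_le_sum fun k _ => hterm i k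
    _ = 2 / σ * Real.exp (2 * μ * r₁) * Real.exp (-(μ * dist (loc u) (loc v))) * ((∑ k, |u k|) * ∑ i, |v i|) := by
        rw [Finset.sum_mul_sum]
        simp only [Finset.mul_sum]
        exact Finset.sum_comm
    _ ≤ 2 / σ * Real.exp (2 * μ * r₁) * Real.exp (-(μ * dist (loc u) (loc v))) * (L₁ * L₁) :=
        mul_le_mul_of_nonneg_left (mul_le_mul (hl1 u hu) (hl1 v hv) (Finset.sum_nonneg fun _ _ => abs_nonneg _) hL)
          (mul_nonneg (mul_nonneg hσ0 (Real.exp_pos _).le) (Real.exp_pos _).le)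
    _ = _ := by ring

/-- **The source bracket is bounded** (the hypothesis `hBf`): `|⟨A⁻¹u, ℱ⟩| ≤ (2/σ)·L₁·‖ℱ‖₁` for `u ∈ Dir`.
[cite: CombesThomas1973, §II] [cite: BalabanImbrieJaffe1988, §5.14 p.311] -/
theorem bracket_source_le (hσ : 0 < σ) (hμ : 0 ≤ μ) (hband : ∀ i k : S, 1 < dist i k → A i k = 0) (hh0 : 0 ≤ h)
    (hh : ∀ i k : S, i ≠ k → |A i k| ≤ h) (hz : ∀ i : S, ((univ.filter fun k => k ≠ i ∧ dist i k ≤ 1).card : ℝ) ≤ z)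
    (hpos : ∀ ω : S → ℝ, σ * (ω ⬝ᵥ ω) ≤ ω ⬝ᵥ A.mulVec ω) (hsmall : h * z * (Real.exp μ - 1) ≤ σ / 2)
    {Dir : Set (S → ℝ)} {L₁ : ℝ} (hl1 : ∀ w ∈ Dir, ∑ x, |w x| ≤ L₁) (f : S → ℝ) :
    ∀ u ∈ Dir, |(A⁻¹ *ᵥ u) ⬝ᵥ f| ≤ 2 / σ * L₁ * ∑ i, |f i| := by
  intro u hu
  have hσ0 : 0 ≤ 2 / σ := div_nonneg zero_le_two hσ.le
  have hL : 0 ≤ L₁ := (Finset.sum_nonneg fun _ _ => abs_nonneg _).trans (hl1 u hu)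
  have e : (A⁻¹ *ᵥ u) ⬝ᵥ f = ∑ i, ∑ k, A⁻¹ i k * u k * f i := by
    simp only [dotProduct, Matrix.mulVec, Finset.sum_mul]
  rw [e]
  have hterm : ∀ i k, |A⁻¹ i k * u k * f i| ≤ 2 / σ * (|u k| * |f i|) := by
    intro i k
    rw [abs_mul, abs_mul, mul_assoc]
    refine mul_le_mul_of_nonneg_right ((inv_entry_decay hσ hμ hband hh0 hh hz hpos hsmall i k).trans ?_)
      (mul_nonneg (abs_nonneg _) (abs_nonneg _))
    exact mul_le_of_le_one_right hσ0 (Real.exp_le_one_iff.2 (neg_nonpos.2 (mul_nonneg hμ dist_nonneg)))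
  calc |∑ i, ∑ k, A⁻¹ i k * u k * f i| ≤ ∑ i, |∑ k, A⁻¹ i k * u k * f i| := Finset.abs_sum_le_sum_abs _ _
    _ ≤ ∑ i, ∑ k, |A⁻¹ i k * u k * f i| := Finset.sum_le_sum fun i _ => Finset.abs_sum_le_sum_abs _ _
    _ ≤ ∑ i, ∑ k, 2 / σ * (|u k| * |f i|) := Finset.sum_le_sum fun i _ => Finset.sum_le_sum fun k _ => hterm i k
    _ = 2 / σ * ((∑ k, |u k|) * ∑ i, |f i|) := by
        rw [Finset.sum_mul_sum]
        simp only [Finset.mul_sum]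
        exact Finset.sum_comm
    _ ≤ 2 / σ * (L₁ * ∑ i, |f i|) :=
        mul_le_mul_of_nonneg_left (mul_le_mul_of_nonneg_right (hl1 u hu) (Finset.sum_nonneg fun _ _ => abs_nonneg _))
          hσ0
    _ = _ := by ring

end Brackets

/-! ## §2  The diameter decay for a banded coercive precision -/

section Expand

variable {ι : Type} [Fintype ι] {κ : Type} [LinearOrder κ]
variable {A : Matrix S S ℝ} {f : S → ℝ} {c : ι → ℝ} {legs : ι → List (S → ℝ)} {obs : κ → List (S → ℝ)} {M : ℕ}
  {Dir : Set (S → ℝ)} {loc : (S → ℝ) → S} {σ h z μ cM r₀ r₁ L₁ : ℝ}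

/-- **EVERY BLOCK AND EVERY REMAINDER COMPONENT CARRIES `e^{−μ·diam}`, FOR A BANDED COERCIVE PRECISION**
(`BIJ88LabelledDiamDecay312.expand_decay_bound_init` with its bracket hypotheses discharged by `bracket_decay` /
`bracket_source_le`): with `B := max((2/σ)e^{2μr₁}L₁², (2/σ)L₁‖ℱ‖₁)`, for every `t ∈ expand 0 K`,
`|coef_t| · exp(μ·Σ_X diam(cubes X)) ≤ (max B 1)^{Φ₀(K)} · e^{μ r₀ |K|} · (c_M e^{μ r₀})^{nv_t}`.
[cite: BalabanImbrieJaffe1988, §5.14 p.311–312] -/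
theorem expand_decay_bound_banded (hσ : 0 < σ) (hμ : 0 ≤ μ) (hband : ∀ i k : S, 1 < dist i k → A i k = 0)
    (hh0 : 0 ≤ h) (hh : ∀ i k : S, i ≠ k → |A i k| ≤ h)
    (hz : ∀ i : S, ((univ.filter fun k => k ≠ i ∧ dist i k ≤ 1).card : ℝ) ≤ z)
    (hpos : ∀ ω : S → ℝ, σ * (ω ⬝ᵥ ω) ≤ ω ⬝ᵥ A.mulVec ω) (hsmall : h * z * (Real.exp μ - 1) ≤ σ / 2)
    (hL : 0 ≤ L₁) (hsupp : ∀ w ∈ Dir, ∀ x, w x ≠ 0 → dist x (loc w) ≤ r₁) (hl1 : ∀ w ∈ Dir, ∑ x, |w x| ≤ L₁)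
    (hr : 0 ≤ r₀) (hcM : 0 ≤ cM) (hcm : ∀ m, |c m| ≤ cM)
    (hobs : ∀ j, ∀ w ∈ obs j, w ∈ Dir) (hlegs : ∀ m, ∀ w ∈ legs m, w ∈ Dir)
    (hro : ∀ j, ∀ w ∈ obs j, ∀ w' ∈ obs j, dist (loc w) (loc w') ≤ r₀)
    (hrv : ∀ m, ∀ w ∈ legs m, ∀ w' ∈ legs m, dist (loc w) (loc w') ≤ r₀) (K : Finset κ) :
    ∀ t ∈ expand A f c legs obs M 0 K,
      |t.coef| * Real.exp (μ * ((t.consts + t.groups).map fun g => Metric.diam (cubes loc obs g)).sum)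
        ≤ (max (max (2 / σ * Real.exp (2 * μ * r₁) * L₁ ^ 2) (2 / σ * L₁ * ∑ i, |f i|)) 1)
            ^ (∑ j ∈ K, ((obs j).length + 1 + M * maxArity legs)) * Real.exp (μ * (r₀ * K.card))
          * (cM * Real.exp (μ * r₀)) ^ t.nv := by
  have hBd : ∀ u ∈ Dir, ∀ v ∈ Dir, |(A⁻¹ *ᵥ u) ⬝ᵥ v|
      ≤ max (2 / σ * Real.exp (2 * μ * r₁) * L₁ ^ 2) (2 / σ * L₁ * ∑ i, |f i|) * Real.exp (-(μ * dist (loc u) (loc v))) :=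
    fun u hu v hv => (bracket_decay hσ hμ hband hh0 hh hz hpos hsmall loc hL hsupp hl1 u hu v hv).trans
      (mul_le_mul_of_nonneg_right (le_max_left _ _) (Real.exp_pos _).le)
  have hBf : ∀ u ∈ Dir, |(A⁻¹ *ᵥ u) ⬝ᵥ f| ≤ max (2 / σ * Real.exp (2 * μ * r₁) * L₁ ^ 2) (2 / σ * L₁ * ∑ i, |f i|) :=
    fun u hu => (bracket_source_le hσ hμ hband hh0 hh hz hpos hsmall hl1 f u hu).trans (le_max_right _ _)
  exact expand_decay_bound_init hμ hr hBd hBf hcM hcm hobs hlegs hro hrv K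

end Expand

end Literature.MathematicalPhysics.QuantumFieldTheory.BalabanImbrieJaffe1984to88.BIJ88BracketDecay311

end
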